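import Summits.BirchSwinnertonDyer.BirchSwinnertonDyer.Theorems.ManinLocalTwoThreeTVRigidityRows
import Summits.BirchSwinnertonDyer.BirchSwinnertonDyer.Theorems.ManinLocalTwoThreeTVResolution
import Summits.BirchSwinnertonDyer.BirchSwinnertonDyer.Theorems.ManinLocalTwoThreeTVClassIndep
import Summits.BirchSwinnertonDyer.BirchSwinnertonDyer.Theorems.ManinLocalTwoThreeMultiHubByName
import HarnessLib

/-!
# E-an-142 `TVPatternRigidity` IS A THEOREM OF THE TREE: `MultiHubImpliesRigidity` holds, hence `TVPatternRigidityLaw p` for every prime `p`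

Summit `BirchSwinnertonDyer`, route `ManinLocalTwoThree` (cell bsd-f2-manin), cruxes C2 `ManinOddAtFour` (stmt-BirchSwinnertonDyer-22967) /
C3 `ManinPrimeToThreeAtNine` (stmt-…-22968) through the tower input E-an-135 (`TowerUnitTwistGeFive`) ⟸ `RigidityImpliesTower` (paper) ∧
E-an-142 `TVPatternRigidityLaw` ⟸ `MultiHubImpliesRigidity` ∧ `MultiHubRigidLaw` (typer's `…/ManinAdditive/TowerRigidity.lean`, p674557).
Prover seat bsd-line-manin23-p1 (C2/C3 LEAD), gen 10 — the ASSEMBLY of the work split p1/p2 (STATUS 22:48Z/22:49Z):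

* (5.0) resolution — `tv_resolution` (`…TVResolution.lean`, p1, every `s`);
* (5.1)–(5.3), (5.5) LEMMA A, the deep rows, the integer multi-hub equation `fine_multiHub`, `linearity` — `…TVRigidityLemmaA.lean`,
  `…TVRigidityRows.lean` (p1; port of the an planner's L9 skeleton `HOME/an/g30/TowerRigiditySkeleton-an-g30.lean`);
* (5.4) class-independence — `tv_classIndep` (`…TVClassIndep.lean`, p2, consuming `fine_multiHub` and LEMMA MH `MultiHubRigid`);
* (5.4c) LEMMA MH — `multiHubRigidLaw_holds` (`…MultiHubByName.lean`, p2).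

Main declarations:
* `tv_conclusion_of_classIndep` — composition for given data (`s ≥ 1`): class-independence ⟹ `∃ κ', g n r = κ'·n` on the integers prime to `q`;
* **`multiHubImpliesRigidity_holds : MultiHubImpliesRigidity`** — the obligation node of `TowerRigidity.lean` DISCHARGED;
* **`tvPatternRigidityLaw_holds : p.Prime → TVPatternRigidityLaw p`**, `tvPatternRigidity_holds` — E-an-142 BY NAME for every prime `p`, every
  level `N` and every `q` (the case `s = 0` by `eq_zero_of_tv_zero`; the binders `5 ≤ q` and, for the rigidity edge, `a, κ` are idle);
* `towerUnitTwistGeFive_of_rigidityImpliesTower`, `someTowerUnitTwist_of_rigidityImpliesTower` — the typer's chain with BOTH Lean rows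
  discharged: the `q ≥ 5` tower law E-an-135 / its ∃q-form E-an-135♭ now rest on the SINGLE paper row `RigidityImpliesTower` (E-an-143 + E-an-140).

HONEST FRAMING: E-an-142 is elementary arithmetic (PROOFS-an-72 §5, an g30) and is now kernel-checked; the tower law E-an-135 itself is NOT proved
here (`RigidityImpliesTower` remains an obligation node), and C2, C3, Manin's conjecture and BSD are NOT proved by this file.  No definitions, no sorry.
-/

set_option autoImplicit false
set_option linter.dupNamespace false

namespace Summit.BirchSwinnertonDyer.BirchSwinnertonDyer.Theorems.ManinLocalTwoThree.TVRigidity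

open Matrix Finset
open scoped MatrixGroups
open Summit.BirchSwinnertonDyer.Rank1Residual.ManinAdditive.TowerExtension
  Summit.BirchSwinnertonDyer.Rank1Residual.ManinAdditive.KatoCurve

variable {N q p s : ℕ} {g : ℕ → ℤ → ZMod p} {c : SL(2, ℤ) → ZMod p}

/-! ### §1. Composition for given data -/

/-- **E-an-142's conclusion from class-independence** (`s ≥ 1`; the composition step of the an planner's skeleton): with (P0) (P1) (EV) (INV),
the resolution `hres` and class-independence `hci`, `g n r = κ'·n` for every `n` and every `r` prime to `q`, with `κ' = g 1 1`
(`linearity` + `linear_of_second_diff`). -/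
theorem tv_conclusion_of_classIndep (hq : q.Prime) (hqpN : ¬ q ∣ p * N) (hN0 : 0 < N) (hs : 1 ≤ s)
    (level0 : ∀ r : ℤ, g 0 r = 0)
    (period : ∀ (n : ℕ) (r : ℤ), g n (r + (q : ℤ) ^ n) = g n r)
    (even : ∀ (n : ℕ) (r : ℤ), g n (-r) = g n r)
    (inv : ∀ γ : SL(2, ℤ), (N : ℤ) ∣ (γ : Matrix (Fin 2) (Fin 2) ℤ) 1 0 →
      ∀ (r : ℤ) (i j : ℕ) (ε : ℤˣ),
        (γ : Matrix (Fin 2) (Fin 2) ℤ) 1 0 * r + (γ : Matrix (Fin 2) (Fin 2) ℤ) 1 1 * (q : ℤ) ^ i = (ε : ℤ) * (q : ℤ) ^ j →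
        g j ((ε : ℤ) * ((γ : Matrix (Fin 2) (Fin 2) ℤ) 0 0 * r + (γ : Matrix (Fin 2) (Fin 2) ℤ) 0 1 * (q : ℤ) ^ i)) - g i r = c γ)
    (hres : ∀ (n : ℕ) (r t : ℤ), s ≤ n → IsCoprime r (q : ℤ) → g n (r + t * (q : ℤ) ^ s) = g n r)
    (hci : ∀ (e : ℕ) (r r' : ℤ), IsCoprime r (q : ℤ) → IsCoprime r' (q : ℤ) → g e r = g e r') :
    ∃ κ' : ZMod p, ∀ (n : ℕ) (r : ℤ), IsCoprime r (q : ℤ) → g n r = κ' * (n : ZMod p) := by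
  have hsd := linearity level0 period even inv hres hq hqpN hN0 hs hci
  refine ⟨g 1 1, fun n r hr ↦ ?_⟩
  rw [hci n r 1 hr isCoprime_one_left]
  exact linear_of_second_diff (fun n ↦ g n 1) (level0 1) hsd n

/-! ### §2. `MultiHubImpliesRigidity` holds; E-an-142 by name -/

/-- **`MultiHubImpliesRigidity` HOLDS** (the obligation node of `…/ManinAdditive/TowerRigidity.lean`; PROOFS-an-72 §5 (5.0)–(5.5) in Lean):
LEMMA MH ⟹ E-an-142 `TVPatternRigidityLaw p` for every prime `p`.  For the data of `TVPatternRigidity N q p`: if `s = 0` everything vanishes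
(`eq_zero_of_tv_zero`); if `s ≥ 1`: resolution (`tv_resolution`), the multi-hub equation (`fine_multiHub`), class-independence (`tv_classIndep`, p2)
with `MultiHubRigid q p` from the law, and the composition `tv_conclusion_of_classIndep`. -/
theorem multiHubImpliesRigidity_holds : MultiHubImpliesRigidity := by
  intro hMHlaw p hp N q hq _h5 hqpN hadm hN a κ s g c level0 period unreduce even tv kappa hecke inv
  have hqp : ¬ q ∣ p := not_dvd_of_not_dvd_mul_level hqpN
  have hqN : Nat.Coprime q N := (Nat.Prime.coprime_iff_not_dvd hq).mpr fun h ↦ hqpN (dvd_mul_of_dvd_right h p)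
  rcases Nat.eq_zero_or_pos s with rfl | hs
  · exact ⟨0, fun n r _ ↦ by
      rw [eq_zero_of_tv_zero g hq hqp a κ level0 period unreduce tv kappa hecke n r, zero_mul]⟩
  · have hqnep : q ≠ p := fun h ↦ hqp (h ▸ dvd_rfl)
    have hq3 : 3 ≤ q := by omega
    have hMH : MultiHubRigid q p := hMHlaw q p hq hp hq3 hqnep hadm
    have hres := tv_resolution g hq hqp a κ level0 period unreduce tv kappa hecke
    have hci := tv_classIndep hq hqN hs level0 period unreduce even hMH hres
      (fine_multiHub level0 period even inv hres hq hqpN hN hs)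
    exact tv_conclusion_of_classIndep hq hqpN hN hs level0 period even inv hres hci

/-- **E-an-142 `TVPatternRigidityLaw p` HOLDS for every prime `p`** (BY NAME; LEMMA MH = p2's `multiHubRigidLaw_holds`). -/
theorem tvPatternRigidityLaw_holds {p : ℕ} (hp : p.Prime) : TVPatternRigidityLaw p :=
  multiHubImpliesRigidity_holds multiHubRigidLaw_holds p hp

/-- **E-an-142 `TVPatternRigidity N q p`** for every level `N`, every `q` and every prime `p` (BY NAME). -/
theorem tvPatternRigidity_holds (N q : ℕ) {p : ℕ} (hp : p.Prime) : TVPatternRigidity N q p :=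
  tvPatternRigidityLaw_holds hp N q

/-! ### §3. The tower chain with both Lean rows discharged -/

/-- **The `q ≥ 5` tower law E-an-135 `TowerUnitTwistGeFive p` ⟸ the single paper row `RigidityImpliesTower`** (typer's
`towerUnitTwistGeFive_of_multiHub` with `MultiHubRigidLaw` and `MultiHubImpliesRigidity` discharged). -/
theorem towerUnitTwistGeFive_of_rigidityImpliesTower (hR : RigidityImpliesTower) {p : ℕ} (hp : p.Prime) :
    TowerUnitTwistGeFive p :=
  towerUnitTwistGeFive_of_multiHub multiHubRigidLaw_holds multiHubImpliesRigidity_holds hR hp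

/-- **E-an-135♭ `SomeTowerUnitTwist p` ⟸ `RigidityImpliesTower`** (every prime `p`; the ∃q-form consumed by the C2/C3 cells via
`threeAdicWitness_of_someTowerUnitTwist` / `twoAdicWitness_of_someTowerUnitTwist`). -/
theorem someTowerUnitTwist_of_rigidityImpliesTower (hR : RigidityImpliesTower) {p : ℕ} (hp : p.Prime) : SomeTowerUnitTwist p :=
  someTowerUnitTwist_of_multiHub multiHubRigidLaw_holds multiHubImpliesRigidity_holds hR hp

end Summit.BirchSwinnertonDyer.BirchSwinnertonDyer.Theorems.ManinLocalTwoThree.TVRigidity
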